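import Summits.BirchSwinnertonDyer.BirchSwinnertonDyer.Theorems.ErratumRoadFiveNonSurjCornerTwinMuAnUnitValue
import Literature.NumberTheory.EllipticCurves.PAdicBSD
import Literature.NumberTheory.EllipticCurves.IwasawaLeadingTermProofs
import HarnessLib

/-!
# Route `ErratumRoadFive` (rung K2), crux child `NonSurjCornerTwinMuAn` (item stmt-BirchSwinnertonDyer-19948, parent
# 19065 `NonSurjCorner`): the SPLIT stub `stub_twinMuAn_split` ON THE UNIT-DERIVATIVE LOCUS — at a split multiplicative
# prime the constant term of the Mazur–Tate–Teitelbaum function vanishes (exceptional zero) and, by Greenberg–Stevens,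
# the LINEAR coefficient of the Néron-normalised `ϖ·L` is `ϖ·𝓛_p(E^d)·L(E^d,1)/Ω⁺ / log_p(γ)`; so
# `ord_p(ϖ·𝓛_p·[0]⁺_f) = 1` IS the certificate (cell `bsd-stepL`, seat `bsd-stepL-corner5-p2` g6, WIDTH-LEVER lane B;
# `--supports stmt-BirchSwinnertonDyer-19948 --as helper`)

WHAT. Companion of corner-p1 g7's `Theorems/ErratumRoadFiveNonSurjCornerTwinMuAnUnitValue.lean`, which serves the
NON-split stub of the registered line `Cruxes/NonSurjCornerTwinMuAn/Lines/birth.lean` on the unit-VALUE locus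
(`[T⁰](ϖ·L) = 2ϖ·[0]⁺_f`). On the SPLIT branch (`a = a_p(Wd) = +1`) the interpolation package
`IsMultPAdicLFunctionOf f p 1 L` is the prelude's `IsSplitMultPAdicLFunctionOf f p L`
(`isMultPAdicLFunctionOf_one_iff`), whose constant term is `(1 − 1)·[0]⁺_f = 0` — the exceptional zero of
Mazur–Tate–Teitelbaum — so NO special VALUE can certify `μ_an = 0`; the first available coefficient is `[T¹]`, and the
Greenberg–Stevens formula (PUBLISHED; tree fact `Literature.NumberTheory.EllipticCurves.greenberg_stevens`, conjunct 14
of the corner's support bundle `KatoTwinFactsFiveAn`; printed for `p ≥ 5` by Greenberg–Stevens 1993 and for every odd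
`p` by Kobayashi 2006 Cor. 4.2) reads `[T¹]L · log_p(γ) = 𝓛_p(Wd)·[0]⁺_f` with `𝓛_p = log_p q / ord_p q` the
`𝓛`-invariant of a Tate-parameter datum `Dq`. Since `log_p(γ) = log_p(1+p) = p·u` with `u ∈ ℤ_pˣ` (`p` odd; tree
theorem `exists_unit_padicLog_cyclotomicGenerator`), the EXACT identity
`‖[T¹](ϖ·L)‖_p = p · ‖ϖ·𝓛_p(Wd)·[0]⁺_f‖_p` follows (§1), and the split stub holds at every twin where
`‖ϖ·𝓛_p·[0]⁺_f‖_p = p⁻¹`, i.e. `ord_p(ϖ·𝓛_p(Wd)·L(Wd,1)/Ω⁺_f) = 1` (§2–§3) — the decidable per-pair certificate of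
the BC5 road on the split branch (Tate parameter to finite precision + one modular symbol; this is what the cell's
CERT-TWINMUAN-5 table computes at the split corner twins).

* §1 `MuAnUnit.constantCoeff_eq_zero_of_one`, `MuAnUnit.coeff_one_mul_padicLog_eq_of_one` (Greenberg–Stevens read through
  `isMultPAdicLFunctionOf_one_iff`), `MuAnUnit.norm_padicLog_cyclotomicGenerator` (`‖log_p γ‖ = p⁻¹`, `p` odd),
  **`MuAnUnit.norm_coeff_one_C_mul_of_one`**: `‖[T¹](ϖ·L)‖ = p·‖ϖ·𝓛·[0]⁺_f‖`.
* §2 `MuAnUnit.exists_norm_coeff_eq_one_of_one`: `‖ϖ·𝓛·[0]⁺_f‖ = p⁻¹ ⟹ ∃ n, ‖[Tⁿ](ϖ·L)‖ = 1` (`n = 1`).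
* §3 **`Theorems.nonSurjCornerTwinMuAn_split_of_unit_derivative`** — the registered stub `stub_twinMuAn_split` of 19948
  VERBATIM plus: the Greenberg–Stevens fact BY NAME (`hGS`), a Tate-parameter datum `Dq` of `Wd` at `p` (it exists iff
  `Wd` is split multiplicative at `p`, Silverman ATAEC V.5.3 = tree fact `nonempty_tateParameterData_iff`; taken as a
  binder, not constructed), and ONE hypothesis «`‖ϖ·𝓛_p(Wd)·[0]⁺_f‖_p = p⁻¹`».

HONEST FRAMING: theorems only (no definition, no named fact introduced, no `sorry`); CONDITIONAL on the displayed
published fact `greenberg_stevens` (consumed by name) and the per-twin unit-derivative hypothesis; nothing is asserted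
about any curve; the OPEN content of the split stub is the complementary locus (split twins with
`ord_p(ϖ·𝓛_p·[0]⁺_f) ≥ 2`, where the first unit coefficient — if any — sits deeper); item 19948 does NOT close; BSD is
advanced for no class; no census word moves (T7).

References: [GreenbergStevens1993] Thm. (0.3) = Thm. 7.1; [Kobayashi2006DocMath] Cor. 4.2 (p. 575);
[MazurTateTeitelbaum1986Invent] §I.10, §I.14, §II.1; [GreenbergLNM1716] §4 (PDF p. 113), Conj. 1.11 (shape);
[Iwasawa1972PadicL] §4.4 (`log_p` on `1 + pℤ_p`); tree: `PAdicBSD.lean` (`greenberg_stevens`), `PAdicHeights.lean`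
(`TateParameterData`, `LInvariant`), `PAdicLFunctionMultiplicativeInterpolation.lean`, `IwasawaLeadingTermProofs.lean`.
-/

set_option autoImplicit false
set_option linter.dupNamespace false

noncomputable section

open scoped Classical NumberField MatrixGroups ModularForm

namespace Summit.BirchSwinnertonDyer.Rank1Residual.X11b.MuAnUnit

open CongruenceSubgroup WeierstrassCurve Literature.NumberTheory.EllipticCurves
  Literature.NumberTheory.EllipticCurves.ModularForms

variable {N : ℕ} {f : CuspForm (Gamma0 N) 2} {p : ℕ} [Fact p.Prime]

/-! ### §1 The linear coefficient of `ϖ·L` at a split prime (Greenberg–Stevens) -/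

/-- **Exceptional zero**: at a split multiplicative prime (`a = 1`) the constant term of `L` vanishes,
`L(0) = (1 − 1)·[0]⁺_f = 0`. [cite: MazurTateTeitelbaum1986Invent, §I.15 Proposition, case I (p. 21)] -/
theorem constantCoeff_eq_zero_of_one {L : PowerSeries ℚ_[p]} (hL : IsMultPAdicLFunctionOf f p 1 L) :
    PowerSeries.constantCoeff L = 0 := by
  rw [hL.2.1]; simp

/-- **Greenberg–Stevens, read on the multiplicative interpolation package**: for `Wd` split multiplicative at `p`
with newform `f`, Tate datum `Dq` and `L` with `IsMultPAdicLFunctionOf f p 1 L`,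
`[T¹]L · log_p(γ) = 𝓛_p(Wd)·[0]⁺_f` (fact `greenberg_stevens` by name, through `isMultPAdicLFunctionOf_one_iff`).
[cite: Kobayashi2006DocMath, Cor. 4.2 (p. 575)] [cite: GreenbergStevens1993, Thm. 7.1] -/
theorem coeff_one_mul_padicLog_eq_of_one {Wd : WeierstrassCurve ℚ} [Wd.IsElliptic] [Wd.IsGloballyMinimal]
    [NeZero N] (hGS : greenberg_stevens (W := Wd) (p := p)) (Dq : TateParameterData Wd p)
    (hf : IsNewformOf Wd f) {L : PowerSeries ℚ_[p]} (hL : IsMultPAdicLFunctionOf f p 1 L) :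
    PowerSeries.coeff 1 L * padicLog p (cyclotomicGenerator p) = LInvariant Dq * (ratPlusSymbol f 0 : ℚ_[p]) :=
  (hGS Dq hf ((isMultPAdicLFunctionOf_one_iff L).mp hL)).2

/-- **`‖log_p(γ)‖_p = p⁻¹` for odd `p`** (`γ = 1 + p`, `log_p γ = p·u`, `u ∈ ℤ_pˣ`; tree theorem
`exists_unit_padicLog_cyclotomicGenerator`). [cite: Iwasawa1972PadicL, §4.4] -/
theorem norm_padicLog_cyclotomicGenerator (hp2 : p ≠ 2) :
    ‖padicLog p (cyclotomicGenerator p : ℚ_[p])‖ = (p : ℝ)⁻¹ := by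
  obtain ⟨u, hu⟩ := exists_unit_padicLog_cyclotomicGenerator (p := p) hp2
  have hunit : ‖((u : ℤ_[p]) : ℚ_[p])‖ = 1 := by
    rw [PadicInt.padic_norm_e_of_padicInt]
    exact PadicInt.isUnit_iff.mp u.isUnit
  rw [hu, norm_mul, hunit, mul_one, Padic.norm_p]

/-- **`‖log_p(γ)‖_p ≠ 0`** (odd `p`). [cite: Iwasawa1972PadicL, §4.4] -/
theorem padicLog_cyclotomicGenerator_ne_zero (hp2 : p ≠ 2) :
    padicLog p (cyclotomicGenerator p : ℚ_[p]) ≠ 0 := by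
  intro h
  have h1 := norm_padicLog_cyclotomicGenerator (p := p) hp2
  rw [h, norm_zero] at h1
  have hp0 : (0 : ℝ) < (p : ℝ)⁻¹ := inv_pos.mpr (by exact_mod_cast (Fact.out : p.Prime).pos)
  exact absurd h1 (ne_of_lt hp0)

/-- **THE EXACT SIZE OF THE LINEAR COEFFICIENT at a split prime** (`p` odd): for `L` with `IsMultPAdicLFunctionOf f p 1 L`,
a Tate datum `Dq` and the Greenberg–Stevens fact, `‖[T¹](ϖ·L)‖_p = p · ‖ϖ·𝓛_p(Wd)·[0]⁺_f‖_p`. So the linear coefficient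
of the Néron-normalised function is a `p`-adic unit iff `ord_p(ϖ·𝓛_p·[0]⁺_f) = 1`.
[cite: Kobayashi2006DocMath, Cor. 4.2 (p. 575)] [cite: MazurTateTeitelbaum1986Invent, §II.1] -/
theorem norm_coeff_one_C_mul_of_one (hp2 : p ≠ 2) {Wd : WeierstrassCurve ℚ} [Wd.IsElliptic] [Wd.IsGloballyMinimal]
    [NeZero N] (hGS : greenberg_stevens (W := Wd) (p := p)) (Dq : TateParameterData Wd p)
    (hf : IsNewformOf Wd f) {L : PowerSeries ℚ_[p]} (hL : IsMultPAdicLFunctionOf f p 1 L) (c : ℚ_[p]) :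
    ‖PowerSeries.coeff 1 (PowerSeries.C c * L)‖ =
      (p : ℝ) * ‖c * LInvariant Dq * (ratPlusSymbol f 0 : ℚ_[p])‖ := by
  have hγ := norm_padicLog_cyclotomicGenerator (p := p) hp2
  have hγ0 := padicLog_cyclotomicGenerator_ne_zero (p := p) hp2
  have hkey : PowerSeries.coeff 1 (PowerSeries.C c * L) * padicLog p (cyclotomicGenerator p) =
      c * LInvariant Dq * (ratPlusSymbol f 0 : ℚ_[p]) := by
    rw [PowerSeries.coeff_C_mul, mul_assoc, coeff_one_mul_padicLog_eq_of_one hGS Dq hf hL, mul_assoc]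
  have hp0 : (p : ℝ) ≠ 0 := by exact_mod_cast (Fact.out : p.Prime).ne_zero
  have hn : ‖PowerSeries.coeff 1 (PowerSeries.C c * L)‖ * (p : ℝ)⁻¹ =
      ‖c * LInvariant Dq * (ratPlusSymbol f 0 : ℚ_[p])‖ := by
    rw [← hγ, ← norm_mul, hkey]
  calc ‖PowerSeries.coeff 1 (PowerSeries.C c * L)‖
      = ‖PowerSeries.coeff 1 (PowerSeries.C c * L)‖ * (p : ℝ)⁻¹ * (p : ℝ) := by
        rw [mul_assoc, inv_mul_cancel₀ hp0, mul_one]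
    _ = (p : ℝ) * ‖c * LInvariant Dq * (ratPlusSymbol f 0 : ℚ_[p])‖ := by rw [hn, mul_comm]

/-! ### §2 A unit first derivative is the certificate -/

/-- **Unit derivative ⟹ analytic μ = 0 certificate at `n = 1` (split prime, `p` odd).** If
`‖ϖ·𝓛_p(Wd)·[0]⁺_f‖_p = p⁻¹` (i.e. `ord_p = 1`) then `[T¹](ϖ·L)` is a `p`-adic unit.
[cite: Kobayashi2006DocMath, Cor. 4.2 (p. 575)] [cite: GreenbergLNM1716, §4 (PDF p. 113)] -/
theorem exists_norm_coeff_eq_one_of_one (hp2 : p ≠ 2) {Wd : WeierstrassCurve ℚ} [Wd.IsElliptic]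
    [Wd.IsGloballyMinimal] [NeZero N] (hGS : greenberg_stevens (W := Wd) (p := p)) (Dq : TateParameterData Wd p)
    (hf : IsNewformOf Wd f) {L : PowerSeries ℚ_[p]} (hL : IsMultPAdicLFunctionOf f p 1 L) (ϖ : ℚ)
    (hunit : ‖((ϖ : ℚ) : ℚ_[p]) * LInvariant Dq * (ratPlusSymbol f 0 : ℚ_[p])‖ = (p : ℝ)⁻¹) :
    ∃ n : ℕ, ‖PowerSeries.coeff n (PowerSeries.C ((ϖ : ℚ) : ℚ_[p]) * L)‖ = 1 := by
  refine ⟨1, ?_⟩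
  have hp0 : (p : ℝ) ≠ 0 := by exact_mod_cast (Fact.out : p.Prime).ne_zero
  rw [norm_coeff_one_C_mul_of_one hp2 hGS Dq hf hL, hunit, mul_inv_cancel₀ hp0]

/-- Conversely, on the split branch the constant coefficient NEVER certifies: `[T⁰](ϖ·L) = 0`.
[cite: MazurTateTeitelbaum1986Invent, §I.15 Proposition, case I (p. 21)] -/
theorem coeff_zero_C_mul_of_one {L : PowerSeries ℚ_[p]} (hL : IsMultPAdicLFunctionOf f p 1 L) (c : ℚ_[p]) :
    PowerSeries.coeff 0 (PowerSeries.C c * L) = 0 := by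
  rw [PowerSeries.coeff_C_mul, PowerSeries.coeff_zero_eq_constantCoeff_apply, constantCoeff_eq_zero_of_one hL,
    mul_zero]

end Summit.BirchSwinnertonDyer.Rank1Residual.X11b.MuAnUnit

namespace Summit.BirchSwinnertonDyer.BirchSwinnertonDyer.Theorems

open CongruenceSubgroup WeierstrassCurve Literature.NumberTheory.EllipticCurves
  Literature.NumberTheory.EllipticCurves.ModularForms Literature.NumberTheory.EllipticCurves.Rank1Residual
  Summit.BirchSwinnertonDyer.Rank1Residual Summit.BirchSwinnertonDyer.Rank1Residual.X11b.MuAnUnit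

/-! ### §3 The analytic child's SPLIT stub on the unit-derivative locus -/

/-- **`stub_twinMuAn_split` of 19948 `NonSurjCornerTwinMuAn` ON THE UNIT-DERIVATIVE LOCUS** — the registered stub text
verbatim (non-surjective X11a leaf twin `Wd`, `p ∈ {5,7}`, `p ∣ ord_p Δ_min`, SPLIT at `p`, newform `f`, period ratio
`ϖ`, MTT function `L` with `a = 1`) plus: the Greenberg–Stevens fact BY NAME (`hGS`, conjunct 14 of
`KatoTwinFactsFiveAn`), a Tate-parameter datum `Dq` of `Wd` at `p` (exists by Silverman ATAEC V.5.3 since `Wd` is split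
at `p`; a binder here), and ONE hypothesis «`‖ϖ·𝓛_p(Wd)·[0]⁺_f‖_p = p⁻¹`»: then `[T¹](ϖ·L)` is the unit coefficient.
`p` is odd because `p ∈ {5,7}`. Most frame binders are unused and displayed only so that the statement is the stub's
text plus the named clauses. Nothing booked.
[cite: Kobayashi2006DocMath, Cor. 4.2 (p. 575)] [cite: GreenbergLNM1716, §4 (PDF p. 113) and §1 Conj. 1.11 (shape)] -/
theorem nonSurjCornerTwinMuAn_split_of_unit_derivative :
    ∀ (Wd : WeierstrassCurve ℚ) [Wd.IsElliptic] [Wd.IsGloballyMinimal] (p : ℕ) [Fact p.Prime],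
      ClassX11a Wd p → ¬ Surj Wd p → (p = 5 ∨ p = 7) → p ∣ padicValInt p Wd.minimalDiscriminantInt →
      Wd.HasSplitMultiplicativeReductionAtPrime p →
      ∀ {N : ℕ} [NeZero N] (f : CuspForm (Gamma0 N) 2), IsNewformOf Wd f →
      ∀ (ϖ : ℚ), (ϖ : ℝ) * Wd.realPeriodRat = plusPeriod f →
      ∀ (L : PowerSeries ℚ_[p]), IsMultPAdicLFunctionOf f p 1 L →
        greenberg_stevens (W := Wd) (p := p) →
        ∀ (Dq : TateParameterData Wd p),
          ‖((ϖ : ℚ) : ℚ_[p]) * LInvariant Dq * (ratPlusSymbol f 0 : ℚ_[p])‖ = (p : ℝ)⁻¹ →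
          ∃ n : ℕ, ‖PowerSeries.coeff n (PowerSeries.C ((ϖ : ℚ) : ℚ_[p]) * L)‖ = 1 := by
  intro Wd _ _ p _ _ _ h57 _ _ N _ f hf ϖ _ L hL hGS Dq hunit
  have hp2 : p ≠ 2 := by rcases h57 with rfl | rfl <;> decide
  exact exists_norm_coeff_eq_one_of_one hp2 hGS Dq hf hL ϖ hunit

end Summit.BirchSwinnertonDyer.BirchSwinnertonDyer.Theorems

end
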